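import Summits.Ventures.CertifiedManyBodySolver.Downfold.BoxesNdNiO2ELadder
import HarnessLib

/-!
# The RE-PRINTED object-E `t'/t_eff` row of NdNiO₂ column M21 as a one-coordinate re-issue `boxNdNiO2E_M21r`, and why neither it nor
# `boxNdNiO2E_M21` refines the other

Venture CertifiedManyBodySolver, cell `pub/hubbard-downfold` (S1; D-0154 (1) (C) COVERAGE (iii) NdNiO₂), seat hubbard-cov-ndnio2-unc-2. Sequel of
`BoxesNdNiO2ELadder.lean` (§3 there: the FLOOR(tp/t) rung `[−183/400, −143/400] = [−0.4575, −0.3575]` of the object-E `t'/t_eff` refit members is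
NOT enclosed by the typed entry `ndNiO2E_M21_tp = [−23/50, −9/25]` on the high side, by `1/400`). SOURCE: `router/BOXES/NdNiO2.md` §R-ac FOLD v1
(run-8 2026-08-27T03:41Z) «LEGACY OUTWARD RE-PRINTS … tp/t (object E) | [−0.458, −0.357] … was [−0.46, −0.36]», adopted by the lead in §OF-RECORD
v1.6 (B) («legacy ROUNDING/GAP rows re-printed outward in the fold block»); the typed companion `boxNdNiO2E_M21` (router.py leanbox) reads the
§OF-RECORD v1.1 object-E print `[−0.46, −0.36]`.

* `ndNiO2E_M21r_tp = [−229/500, −357/1000]`; `boxNdNiO2E_M21r := boxNdNiO2E_M21.withEntry tpOverT ndNiO2E_M21r_tp` (VERSION RULE: a moved edge is a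
  NEW definition); accessors; `ndNiO2E_tp_floor_le_M21r` (the FLOOR rung IS enclosed); corners + `boxNdNiO2E_M21r_energyWord` (the S2 door).
* `boxNdNiO2E_M21_not_refines_M21r` (M21's low edge −0.46 is the wider) and `boxNdNiO2E_M21r_not_refines_M21` (M21r's high edge −0.357 is the
  wider): NEITHER refines the other, so words certified on `boxNdNiO2E_M21` do not reach the strip `t'/t_eff ∈ (−0.36, −0.357]` of the row of
  record, and vice versa for `[−0.46, −0.458)`. Typed so the lead can RULE which is the typed box of record; their hull `[−23/50, −357/1000]` would
  refine both (a hull move is the lead's pen — not typed here).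
* `ndNiO2E_M21r_mem_of_determination`: every admitted determination of the ladder (member hull in `t'/t_eff`) lies in `boxNdNiO2E_M21r` too —
  the disagreement is confined to FLOOR padding and print rounding, no determination is affected.

Everything PROVED (no `sorry`). HONEST FRAMING: bookkeeping of S1's SCREENING-GRADE rows; typing certifies nothing about NdNiO₂; no word, no hull move.
-/

namespace Summit.Ventures.CertifiedManyBodySolver.Downfold

open NonemptyInterval Literature.MathematicalPhysics.QuantumLattice
  Literature.MathematicalPhysics.QuantumLattice.ThermodynamicLimit

/-! ## The re-printed `t'/t_eff` row of record as a one-coordinate re-issue `boxNdNiO2E_M21r` -/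

/-- **`t'/t_eff ∈ [−229/500, −357/1000] = [−0.458, −0.357]`**: run-8's OUTWARD 3-decimal re-print of `floorTo(hull [−0.455, −0.360], FLOOR(tp/t)
±0.05) = [−0.4575, −0.3575]` (§R-ac FOLD v1 «LEGACY OUTWARD RE-PRINTS … tp/t (object E) | [−0.458, −0.357]», 2026-08-27T03:41Z; adopted by the lead
§OF-RECORD v1.6 (B); «values of record; no word reads them»). [folklore] -/
def ndNiO2E_M21r_tp : Entry := Entry.ofEnds (-229/500) (-357/1000) (by norm_num) .screening

/-- **`boxNdNiO2E_M21r`** = `boxNdNiO2E_M21` with the `t'/t_eff` entry re-issued as the re-printed row `ndNiO2E_M21r_tp` (VERSION RULE: a moved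
edge gets a NEW definition; every other entry is `boxNdNiO2E_M21`'s verbatim). [folklore] -/
def boxNdNiO2E_M21r : OneBandBox := boxNdNiO2E_M21.withEntry .tpOverT ndNiO2E_M21r_tp

/-- Accessor: the `tp/t` entry of `boxNdNiO2E_M21r`. [folklore] -/
theorem boxNdNiO2E_M21r_tp : boxNdNiO2E_M21r .tpOverT = some ndNiO2E_M21r_tp := Box.withEntry_self _ _ _
/-- Accessor: the `U/t` entry of `boxNdNiO2E_M21r` is `ndNiO2E_M21_U`. [folklore] -/
theorem boxNdNiO2E_M21r_U : boxNdNiO2E_M21r .UOverT = some ndNiO2E_M21_U := by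
  rw [boxNdNiO2E_M21r, Box.withEntry_of_ne _ _ (by decide)]; rfl
/-- Accessor: the filling entry of `boxNdNiO2E_M21r` is `ndNiO2E_M21_n`. [folklore] -/
theorem boxNdNiO2E_M21r_n : boxNdNiO2E_M21r .filling = some ndNiO2E_M21_n := by
  rw [boxNdNiO2E_M21r, Box.withEntry_of_ne _ _ (by decide)]; rfl
/-- Accessor: the `t_eff` entry of `boxNdNiO2E_M21r` is `ndNiO2E_M21_t`. [folklore] -/
theorem boxNdNiO2E_M21r_t : boxNdNiO2E_M21r .tEV = some ndNiO2E_M21_t := by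
  rw [boxNdNiO2E_M21r, Box.withEntry_of_ne _ _ (by decide)]; rfl
/-- Accessor: the `tpp/t` entry of `boxNdNiO2E_M21r` is `ndNiO2E_M21_tpp` (`0`: object E). [folklore] -/
theorem boxNdNiO2E_M21r_tpp : boxNdNiO2E_M21r .tppOverT = some ndNiO2E_M21_tpp := by
  rw [boxNdNiO2E_M21r, Box.withEntry_of_ne _ _ (by decide)]; rfl

/-- **The FLOOR rung IS enclosed by the re-printed entry**: `floorTo(hull, 1/20) = [−183/400, −143/400] ⊆ [−229/500, −357/1000]`. [folklore] -/
theorem ndNiO2E_tp_floor_le_M21r : ndNiO2E_tp_hull.floorTo (1/20) ≤ ndNiO2E_M21r_tp.encl := by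
  refine ⟨?_, ?_⟩
  · rw [ndNiO2E_tp_floor_ends.1]; simp only [ndNiO2E_M21r_tp, Entry.encl_ofEnds_fst]; norm_num
  · rw [ndNiO2E_tp_floor_ends.2]; simp only [ndNiO2E_M21r_tp, Entry.encl_ofEnds_snd]; norm_num

/-- Corners of the delivered S2 box of `boxNdNiO2E_M21r`: `(5, −0.458, 0.852)` / `(8.5, −0.357, 0.954)`. [folklore] -/
theorem ndNiO2E_M21r_s2LoHi :
    s2Lo ndNiO2E_M21_U ndNiO2E_M21r_tp ndNiO2E_M21_n = ![5, -229/500, 213/250] ∧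
      s2Hi ndNiO2E_M21_U ndNiO2E_M21r_tp ndNiO2E_M21_n = ![17/2, -357/1000, 477/500] := by
  constructor <;> (ext i; fin_cases i <;> simp [s2Lo, s2Hi, ndNiO2E_M21_U, ndNiO2E_M21r_tp, ndNiO2E_M21_n])

/-- **Energy word on `boxNdNiO2E_M21r` from ANY S2 statement of the `_word_Icc` shape on its delivered box**
`Set.Icc ![5, -229/500, 213/250] ![17/2, -357/1000, 477/500]` (order `(U/t, tp/t, n)`). [folklore] -/
theorem boxNdNiO2E_M21r_energyWord {lo hi : ℝ}
    (hW : ∀ θ ∈ Set.Icc (![5, -229/500, 213/250] : Fin 3 → ℝ) ![17/2, -357/1000, 477/500],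
      lo ≤ energyDensityTT' 1 (θ 1) (θ 0) (θ 2) ∧ energyDensityTT' 1 (θ 1) (θ 0) (θ 2) ≤ hi) :
    HoldsOn (fun p : OneBandCoord → ℝ =>
      lo ≤ energyDensityTT' 1 (p .tpOverT) (p .UOverT) (p .filling) ∧
        energyDensityTT' 1 (p .tpOverT) (p .UOverT) (p .filling) ≤ hi) boxNdNiO2E_M21r := by
  have h := holdsOn_of_forall_s2Box (B := boxNdNiO2E_M21r) (eU := ndNiO2E_M21_U) (eS := ndNiO2E_M21r_tp)
    (eN := ndNiO2E_M21_n) boxNdNiO2E_M21r_U boxNdNiO2E_M21r_tp boxNdNiO2E_M21r_n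
    (W := fun θ => lo ≤ energyDensityTT' 1 (θ 1) (θ 0) (θ 2) ∧ energyDensityTT' 1 (θ 1) (θ 0) (θ 2) ≤ hi)
    (by rw [ndNiO2E_M21r_s2LoHi.1, ndNiO2E_M21r_s2LoHi.2]; exact hW)
  exact h

/-- **NON-REFINEMENT 1**: `boxNdNiO2E_M21` does NOT refine `boxNdNiO2E_M21r` — its low `t'/t_eff` edge `−23/50 = −0.46` is wider than the
re-print's `−0.458` (witness: the corner `(5, −0.46, 0.852, 0.38, 0)`). [folklore] -/
theorem boxNdNiO2E_M21_not_refines_M21r : ¬ boxNdNiO2E_M21.Refines boxNdNiO2E_M21r := by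
  intro h
  let p : OneBandCoord → ℝ := fun c =>
    match c with
    | .UOverT => 5 | .tpOverT => -23/50 | .filling => 213/250 | .tEV => 19/50 | _ => 0
  have hp : boxNdNiO2E_M21.Mem p := by
    rw [boxNdNiO2E_M21_mem_iff]; simp only [p]; norm_num
  have hq := (h p hp) .tpOverT ndNiO2E_M21r_tp boxNdNiO2E_M21r_tp
  rw [ndNiO2E_M21r_tp, Entry.mem_ofEnds_iff] at hq
  have h1 := hq.1
  simp only [p] at h1
  norm_num at h1

/-- **NON-REFINEMENT 2**: `boxNdNiO2E_M21r` does NOT refine `boxNdNiO2E_M21` — its high `t'/t_eff` edge `−0.357` is wider than the typed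
companion's `−0.36` (witness: the corner `(5, −0.357, 0.852, 0.38, 0)`). Words certified on `boxNdNiO2E_M21` therefore do NOT transfer to the
re-printed row's strip `t'/t_eff ∈ (−0.36, −0.357]`. [folklore] -/
theorem boxNdNiO2E_M21r_not_refines_M21 : ¬ boxNdNiO2E_M21r.Refines boxNdNiO2E_M21 := by
  intro h
  let p : OneBandCoord → ℝ := fun c =>
    match c with
    | .UOverT => 5 | .tpOverT => -357/1000 | .filling => 213/250 | .tEV => 19/50 | _ => 0
  have hp : boxNdNiO2E_M21r.Mem p := by
    rw [boxNdNiO2E_M21r, Box.mem_withEntry_iff]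
    refine ⟨?_, ?_⟩
    · rw [ndNiO2E_M21r_tp, Entry.mem_ofEnds_iff]; simp only [p]; norm_num
    · intro j hj f hf
      cases j
      case tpOverT => exact absurd rfl hj
      all_goals simp only [boxNdNiO2E_M21, Option.some.injEq, reduceCtorEq] at hf
      all_goals
        subst hf
        simp only [ndNiO2E_M21_U, ndNiO2E_M21_n, ndNiO2E_M21_t, ndNiO2E_M21_tpp, Entry.mem_ofEnds_iff, p]
        norm_num
  have hq := (h p hp) .tpOverT ndNiO2E_M21_tp rfl
  rw [ndNiO2E_M21_tp, Entry.mem_ofEnds_iff] at hq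
  have h2 := hq.2
  simp only [p] at h2
  norm_num at h2

/-- **What both boxes share**: every determination of the ladder's §5 (member hull in `t'/t_eff`, NOT the FLOOR rung) lies in BOTH `boxNdNiO2E_M21` and
`boxNdNiO2E_M21r` — the disagreement is confined to the FLOOR padding `[−0.4575, −0.455) ∪ (−0.360, −0.3575]` and the print roundings. [folklore] -/
theorem ndNiO2E_M21r_mem_of_determination (p : OneBandCoord → ℝ) {U d : ℝ}
    (hU : U ∈ ndNiO2_oneBandU_hull.ratCast ℝ) (ht : p .tEV ∈ ndNiO2E_t_rung.ratCast ℝ) (hUt : p .UOverT = U / p .tEV)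
    (htp : p .tpOverT ∈ ndNiO2E_tp_hull.ratCast ℝ) (hd : d ∈ (ndNiO2_dsd_hull.floorTo (1/20)).ratCast ℝ) (hn : p .filling = 1 - d)
    (htpp : p .tppOverT = 0) : boxNdNiO2E_M21r.Mem p := by
  have hM := ndNiO2E_M21_mem_of_determination p hU ht hUt htp hd hn htpp
  rw [boxNdNiO2E_M21r, Box.mem_withEntry_iff]
  refine ⟨?_, fun j _ f hf => hM j f hf⟩
  have hle : ndNiO2E_tp_hull ≤ ndNiO2E_M21r_tp.encl := (le_floorTo _ _).trans ndNiO2E_tp_floor_le_M21r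
  exact mem_ratCast_of_le hle htp

end Summit.Ventures.CertifiedManyBodySolver.Downfold
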